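import Mathlib.RepresentationTheory.Basic
import Mathlib.GroupTheory.FiniteAbelian.Basic
import Mathlib.LinearAlgebra.Span.Basic
import Mathlib.RingTheory.Finiteness.Basic
import HarnessLib

/-!
# Two `G`-lattices spanning the same `ℚ[G]`-module are commensurable up to a `G`-homomorphism

Topic `RepresentationTheory`; namespace `Literature.RepresentationTheory`.  THEOREMS ONLY (no
definition, no named fact, no `sorry`, no instance).

Serre, *Linear Representations of Finite Groups* §15.1–15.2 (lattices `E₁ ⊂ E` of a `K`-vector
space: finitely generated `A`-submodules spanning `E`; "replacing `E₂` by a scalar multiple `aE₂` we may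
assume `E₂ ⊂ E₁`"; stable lattices and Thm. 32) and Cassels–Fröhlich Ch. VII (Tate) §8.3 ("`M`, `N` are
lattices spanning the same vector space, so `h(N) = h(M)` by Chapter IV, §8").  The elementary step
formalised here: if a finitely generated `ℤ[G]`-module `Λ₁` and a finitely generated `ℤ[G]`-module
`Λ₂` map `G`-equivariantly into one `ℚ[G]`-module `V` (`i₁`, `i₂`), both with `ℚ`-spanning image and
`i₂` injective, then some non-zero integer multiple `N • i₁` factors through `i₂`:

* **`exists_smul_mem_range_of_mem_span`**: every vector of the `ℚ`-span of `i(Λ)` has a non-zero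
  integer multiple in `i(Λ)`;
* **`exists_equivariant_hom_of_span_eq_top`**: there are `N ≠ 0` and a `G`-equivariant `ℤ`-linear
  `j : Λ₁ → Λ₂` with `i₂ ∘ j = N • i₁` whose image has FINITE INDEX in `Λ₂` (`Finite (Λ₂ ⧸ range j)`);
  its kernel is the kernel of `i₁` (`ker_eq_ker_of_comp_eq_smul`), i.e. the torsion of `Λ₁` when `i₁`
  is a rational structure.

With Serre's Thm. 32 / Milne's Lemma 2.12 (tree `StableLatticeReduction*`: an additive invariant of
`Λ/pΛ` does not see a stable sublattice of finite index) this is how an isomorphism of RATIONAL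
representations is turned into an identity between reductions mod `p` of integral structures — e.g.
Herbrand's `(ℚ ⊗ 𝒪_{E,S}^×) ⊕ ℚ ≅ ℚ[S_E ⊔ S_∞(E)]` (tree `EquivariantSUnitRank`) into
`[𝒪_{E,S}^×/p] + [𝔽_p] = [μ(E)[p]] + [𝔽_p[S_E ⊔ S_∞(E)]]` (lane «TATE-EPC-TC» of cell `bsd-eis`,
brick B7c).

## References
* [SerreLinearRepresentations1977] J.-P. Serre, *Linear Representations of Finite Groups*, §15.1
  (lattices), §15.2 Thm. 32.
* [CasselsFrohlichANT1967] Cassels–Fröhlich, *Algebraic Number Theory*, Ch. IV §8 (Herbrand quotient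
  of commensurable lattices), Ch. VII §8.3.
-/

namespace Literature.RepresentationTheory

open Submodule Function

universe u v w

section Span

variable {V : Type v} [AddCommGroup V] [Module ℚ V] {Λ : Type u} [AddCommGroup Λ]

/-- **Every vector of the `ℚ`-span of `i(Λ)` has a non-zero integer multiple in `i(Λ)`** (`i : Λ → V`
additive, `V` a `ℚ`-vector space): clear denominators. [cite: SerreLinearRepresentations1977, §15.1 (lattices span: "`aE₂ ⊂ E₁`")] -/
theorem exists_smul_mem_range_of_mem_span (i : Λ →ₗ[ℤ] V) {v : V}
    (hv : v ∈ span ℚ (Set.range i)) : ∃ n : ℤ, n ≠ 0 ∧ n • v ∈ LinearMap.range i := by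
  induction hv using span_induction with
  | mem x hx =>
    obtain ⟨y, rfl⟩ := hx
    exact ⟨1, one_ne_zero, by rw [one_smul]; exact LinearMap.mem_range_self i y⟩
  | zero => exact ⟨1, one_ne_zero, by rw [smul_zero]; exact zero_mem _⟩
  | add x y _ _ hx hy =>
    obtain ⟨m, hm, hmx⟩ := hx
    obtain ⟨n, hn, hny⟩ := hy
    refine ⟨m * n, mul_ne_zero hm hn, ?_⟩
    rw [smul_add, mul_comm m n, mul_smul, mul_smul]
    exact add_mem (Submodule.smul_mem _ n hmx) (by rw [smul_comm]; exact Submodule.smul_mem _ m hny)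
  | smul q x _ hx =>
    obtain ⟨m, hm, hmx⟩ := hx
    refine ⟨m * q.den, mul_ne_zero hm (Int.natCast_ne_zero.mpr q.den_ne_zero), ?_⟩
    have hq : ((q.den : ℤ) : ℚ) * q = q.num := by
      rw [Int.cast_natCast, mul_comm]
      exact Rat.mul_den_eq_num q
    have : (m * (q.den : ℤ)) • q • x = m • q.num • x := by
      rw [mul_smul, ← Int.cast_smul_eq_zsmul ℚ (q.den : ℤ) (q • x), smul_smul, hq,
        Int.cast_smul_eq_zsmul ℚ q.num x]
    rw [this, smul_comm]
    exact Submodule.smul_mem _ _ hmx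

/-- A finitely generated `ℤ`-module mapping into a `ℚ`-vector space inside the span of `i(Λ)` has a
COMMON denominator: `N • f(x) ∈ i(Λ)` for all `x`, some `N ≠ 0`.
[cite: SerreLinearRepresentations1977, §15.1 (lattices: "`aE₂ ⊂ E₁`")] -/
theorem exists_smul_range_le {Λ' : Type w} [AddCommGroup Λ'] [Module.Finite ℤ Λ'] (i : Λ →ₗ[ℤ] V)
    (f : Λ' →ₗ[ℤ] V) (hf : ∀ x, f x ∈ span ℚ (Set.range i)) :
    ∃ N : ℤ, N ≠ 0 ∧ ∀ x, N • f x ∈ LinearMap.range i := by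
  classical
  obtain ⟨n, s, hs⟩ := Module.Finite.exists_fin (R := ℤ) (M := Λ')
  choose m hm hms using fun k : Fin n => exists_smul_mem_range_of_mem_span i (hf (s k))
  refine ⟨∏ k, m k, Finset.prod_ne_zero_iff.2 fun k _ => hm k, fun x => ?_⟩
  have hx : x ∈ span ℤ (Set.range s) := by rw [hs]; exact mem_top
  induction hx using span_induction with
  | mem y hy =>
    obtain ⟨k, rfl⟩ := hy
    rw [← Finset.mul_prod_erase Finset.univ m (Finset.mem_univ k), mul_comm, mul_smul]
    exact Submodule.smul_mem _ _ (hms k)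
  | zero => rw [map_zero, smul_zero]; exact zero_mem _
  | add y z _ _ hy hz => rw [map_add, smul_add]; exact add_mem hy hz
  | smul a y _ hy => rw [map_smul, smul_comm]; exact Submodule.smul_mem _ a hy

end Span

section Lattices

variable {G : Type w} [Monoid G]
variable {V : Type v} [AddCommGroup V] [Module ℚ V] (τ : Representation ℚ G V)
variable {Λ₁ : Type u} [AddCommGroup Λ₁] [Module.Finite ℤ Λ₁] (ρ₁ : Representation ℤ G Λ₁)
variable {Λ₂ : Type u} [AddCommGroup Λ₂] [Module.Finite ℤ Λ₂] (ρ₂ : Representation ℤ G Λ₂)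

omit [Module.Finite ℤ Λ₁] [Module.Finite ℤ Λ₂] in
/-- If `i₂ ∘ j = N • i₁` with `i₂` injective and `V` torsion-free (`N ≠ 0`), then `ker j = ker i₁`.
[cite: SerreLinearRepresentations1977, §15.1] -/
theorem ker_eq_ker_of_comp_eq_smul (i₁ : Λ₁ →ₗ[ℤ] V) (i₂ : Λ₂ →ₗ[ℤ] V) (hi₂ : Injective i₂)
    (j : Λ₁ →ₗ[ℤ] Λ₂) {N : ℤ} (hN : N ≠ 0) (hj : ∀ x, i₂ (j x) = N • i₁ x) :
    LinearMap.ker j = LinearMap.ker i₁ := by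
  ext x
  rw [LinearMap.mem_ker, LinearMap.mem_ker, ← map_eq_zero_iff i₂ hi₂, hj]
  constructor
  · intro h
    have h' : (N : ℚ)⁻¹ • ((N : ℚ) • i₁ x) = 0 := by rw [Int.cast_smul_eq_zsmul ℚ N, h, smul_zero]
    rwa [smul_smul, inv_mul_cancel₀ (Int.cast_ne_zero.mpr hN), one_smul] at h'
  · intro h
    rw [h, smul_zero]

/-- **Commensurability of `G`-lattices.**  Let `Λ₁`, `Λ₂` be finitely generated `ℤ[G]`-modules with
`G`-maps `i₁ : Λ₁ → V`, `i₂ : Λ₂ → V` to a `ℚ[G]`-module, both with `ℚ`-spanning image, `i₂`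
injective.  Then for some integer `N ≠ 0` the map `N • i₁` factors as `i₂ ∘ j` with
`j : Λ₁ → Λ₂` `ℤ`-linear and `G`-EQUIVARIANT, and `j(Λ₁)` has finite index in `Λ₂`.
("Replacing a lattice by a multiple `aE₂ ⊂ E₁`"; Cassels–Fröhlich: "`M`, `N` are lattices spanning
the same vector space".) [cite: SerreLinearRepresentations1977, §15.1–§15.2 (stable lattices)]
[cite: CasselsFrohlichANT1967, Ch. VII §8.3] -/
theorem exists_equivariant_hom_of_span_eq_top (i₁ : Λ₁ →ₗ[ℤ] V) (i₂ : Λ₂ →ₗ[ℤ] V)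
    (h₁ : ∀ s x, i₁ (ρ₁ s x) = τ s (i₁ x)) (h₂ : ∀ s x, i₂ (ρ₂ s x) = τ s (i₂ x))
    (hi₂ : Injective i₂) (hsp₁ : span ℚ (Set.range i₁) = ⊤) (hsp₂ : span ℚ (Set.range i₂) = ⊤) :
    ∃ (N : ℤ) (j : Λ₁ →ₗ[ℤ] Λ₂), N ≠ 0 ∧ (∀ x, i₂ (j x) = N • i₁ x) ∧
      (∀ s x, j (ρ₁ s x) = ρ₂ s (j x)) ∧ Finite (Λ₂ ⧸ LinearMap.range j) := by
  classical
  -- a common denominator for `i₁(Λ₁)` inside `i₂(Λ₂)`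
  obtain ⟨N, hN, hN₁⟩ := exists_smul_range_le i₂ i₁ (fun x => by rw [hsp₂]; exact mem_top)
  -- the factorisation `j`
  let e := LinearEquiv.ofInjective i₂ hi₂
  let j : Λ₁ →ₗ[ℤ] Λ₂ :=
    e.symm.toLinearMap ∘ₗ LinearMap.codRestrict (LinearMap.range i₂) (N • i₁) fun x => hN₁ x
  have hj : ∀ x, i₂ (j x) = N • i₁ x := fun x => by
    change i₂ (e.symm ⟨N • i₁ x, hN₁ x⟩) = _
    rw [LinearEquiv.ofInjective_symm_apply]
  refine ⟨N, j, hN, hj, fun s x => hi₂ ?_, ?_⟩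
  · rw [hj, h₂, hj, h₁, map_zsmul]
  · -- finite index: a common denominator for `i₂(Λ₂)` inside `i₁(Λ₁)` gives `M • Λ₂ ≤ j(Λ₁)`
    obtain ⟨M, hM, hM₂⟩ := exists_smul_range_le i₁ i₂ (fun x => by rw [hsp₁]; exact mem_top)
    have hmem : ∀ y : Λ₂, (N * M) • y ∈ LinearMap.range j := fun y => by
      obtain ⟨x, hx⟩ := hM₂ y
      refine ⟨x, hi₂ ?_⟩
      rw [hj, hx, smul_smul, map_zsmul]
    haveI : Module.Finite ℤ (Λ₂ ⧸ LinearMap.range j) := Module.Finite.quotient ℤ _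
    refine Module.finite_of_fg_torsion (Λ₂ ⧸ LinearMap.range j) fun z => ?_
    obtain ⟨y, rfl⟩ := Submodule.mkQ_surjective (LinearMap.range j) z
    refine ⟨⟨N * M, mem_nonZeroDivisors_of_ne_zero (mul_ne_zero hN hM)⟩, ?_⟩
    rw [Submonoid.mk_smul, ← map_zsmul, Submodule.mkQ_apply, Submodule.Quotient.mk_eq_zero]
    exact hmem y

end Lattices

end Literature.RepresentationTheory
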